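import Summits.KontsevichZagierPeriods.KontsevichZagierPeriods.Theorems.RootDecompZetaThreeFrontierWordMatchPreludeP6

/-! lens-1 g11 MatchPrelude.lean v5 @a732c71a §29–§31 (l.1656–2267): Family A of `GapClassMatch` (gapClassMatch_famA), the generic t₂-IBP engine, the duality move on `Δ₃` and the t₀-IBP engine — continuation of the census chain …WordMatchPreludeP1–P6 (critic g3 CLEARED 14:47:07Z, row g3-64). -/

/-! # `RootDecompZetaThreeFrontierWordMatchPreludeP7` — part 1/2 of the mechanical ≤360-line split of `src.lean`
(split by the decomp-kz census seat for landing; mathematics unchanged). -/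

noncomputable section

/-! # §29  M2-SPECIMEN (decomp-kz lens-1 gen 11): the FIRST NON-LAYER FAMILY of `GapClassMatch` — Family A
`q·(1-t₀)^κ₀ (t₀-t₁)^κ₁ t₂^n / (t₀^β₀ t₁^β₁ (1-t₁)^γ₁)` (no `g₂`, no `(012)`/`(12)` poles; `β₁ ≤ n+1` may EXCEED the layer bound `β₁ ≤ 1`)
is lowered into `gzLETwo` by ONE Newton–Leibniz move in `t₂` (rule 3 over the band `0 ≤ t₂ ≤ t₁` above `Δ₂`):
`[Δ₃, famA] ≡ [Δ₂, (q/(n+1))·(1-y₀)^κ₀ (y₀-y₁)^κ₁ y₁^{n+1-β₁}/(y₀^β₀ (1-y₁)^γ₁)]`, a genus-zero datum of dimension 2. -/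

namespace Summit.KontsevichZagierPeriods.RootDecompZetaThreeFrontier.WordLayer

open Set MeasureTheory Literature.NumberTheory.Transcendental
open Literature.ModelTheory.ExponentialFields (IsSemialgebraic)
open Summit.KontsevichZagierPeriods.KontsevichZagierPeriods.Theorems.RootDecompZetaThreeFrontierWordMoves (mem_simplex_two_iff mem_simplex_three_iff)

section GapNL

/-- the closed band `0 ≤ t₂ ≤ t₁` over `Δ₂` -/
def bandB3 : Set (Fin 3 → ℝ) :=
  KZlog.band (KZ.openOrderedSimplex 2) (fun _ : Fin 2 → ℝ => (0 : ℝ)) (fun y : Fin 2 → ℝ => y (Fin.last 1))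

/-- Membership in `bandB3_iff`, unfolded. [bookkeeping] -/
theorem mem_bandB3_iff (z : Fin 3 → ℝ) : z ∈ bandB3 ↔ (0 < z 1 ∧ z 1 < z 0 ∧ z 0 < 1) ∧ 0 ≤ z 2 ∧ z 2 ≤ z 1 := by
  rw [bandB3, KZlog.mem_band, mem_simplex_two_iff]
  exact Iff.rfl

/-- Auxiliary step `bandB3_facts`. [bookkeeping] -/
theorem bandB3_facts {z : Fin 3 → ℝ} (hz : z ∈ bandB3) :
    z 0 ≠ 0 ∧ z 1 ≠ 0 ∧ (1 : ℝ) - z 1 ≠ 0 ∧ (1 : ℝ) - z 2 ≠ 0 ∧ z 0 - z 2 ≠ 0 := by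
  obtain ⟨⟨h1, h10, h0⟩, h2, h21⟩ := (mem_bandB3_iff z).1 hz
  exact ⟨by linarith, by linarith, by linarith, by linarith, by linarith⟩

/-- `bandB3` is `ℚ`-semialgebraic. [BCR1998 §2.2] -/
theorem isSemialgebraic_bandB3 : IsSemialgebraic ℚ bandB3 := by
  have hτ := KZ.isSemialgebraic_openOrderedSimplex 2
  exact KZlog.isSemialgebraic_band
    ((isSemialgebraicFunOn_aeval hτ (0 : MvPolynomial (Fin 2) ℚ)).congr fun y _ => by simp)
    ((isSemialgebraicFunOn_aeval hτ (MvPolynomial.X (Fin.last 1))).congr fun y _ => by simp)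

/-- `Δ₃` as the open band `0 < t₂ < t₁` over `Δ₂` -/
theorem simplex3_eq_openBand : KZ.openOrderedSimplex 3 =
    {z : Fin 3 → ℝ | (Fin.init z : Fin 2 → ℝ) ∈ KZ.openOrderedSimplex 2 ∧ (fun _ : Fin 2 → ℝ => (0 : ℝ)) (Fin.init z) < z (Fin.last 2) ∧
      z (Fin.last 2) < (fun y : Fin 2 → ℝ => y (Fin.last 1)) (Fin.init z : Fin 2 → ℝ)} := by
  ext z
  rw [mem_simplex_three_iff]
  simp only [mem_setOf_eq, mem_simplex_two_iff]
  rw [show (Fin.init z : Fin 2 → ℝ) 0 = z 0 from rfl, show (Fin.init z : Fin 2 → ℝ) 1 = z 1 from rfl,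
    show (Fin.init z : Fin 2 → ℝ) (Fin.last 1) = z 1 from rfl, show z (Fin.last 2) = z 2 from rfl]
  constructor
  · rintro ⟨h2, h21, h10, h0⟩; exact ⟨⟨h2.trans h21, h10, h0⟩, h2, h21⟩
  · rintro ⟨⟨-, h10, h0⟩, h2, h21⟩; exact ⟨h2, h21, h10, h0⟩

/-- Splitting off the last coordinate, `ℝ^{N+1} ≃ ℝ^N × ℝ`, as a volume-preserving measurable
equivalence with inverse `(x, t) ↦ Fin.snoc x t`. [folklore] (verbatim private copy) -/
private theorem exists_measurableEquiv_snoc (N : ℕ) :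
    ∃ e : (Fin (N + 1) → ℝ) ≃ᵐ (Fin N → ℝ) × ℝ,
      MeasurePreserving e volume ((volume : Measure (Fin N → ℝ)).prod (volume : Measure ℝ)) ∧
      ∀ q, e.symm q = Fin.snoc q.1 q.2 := by
  refine ⟨(MeasurableEquiv.piFinSuccAbove (fun _ => ℝ) (Fin.last N)).trans
    MeasurableEquiv.prodComm, ?_, fun q => ?_⟩
  · refine (volume_preserving_piFinSuccAbove (fun _ => ℝ) (Fin.last N)).trans ?_
    rw [Measure.volume_eq_prod]
    exact Measure.measurePreserving_swap
  · show (MeasurableEquiv.piFinSuccAbove (fun _ => ℝ) (Fin.last N)).symm (q.2, q.1) = _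
    rw [MeasurableEquiv.piFinSuccAbove_symm_apply, Fin.insertNthEquiv_last]
    rfl

/-- **Newton–Leibniz over an open band, packaged.** Let `r` be a representation whose domain is
the open band `{(x, t) | x ∈ τ, a x < t < b x}` over a semialgebraic base `τ` with semialgebraic
`a < b`, and whose integrand agrees there with `f`; let `F`, `f` be semialgebraic on the closed band;
suppose `t ↦ F (x, t)` is continuous on `[a x, b x]` with derivative `f (x, ·)` on `(a x, b x)`
for `x ∈ τ`. Then `[r] ≡ [τ, F (x, b x) − F (x, a x)]` modulo relations; the base integrand is
absolutely integrable by Fubini and the fundamental theorem of calculus.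
[Kontsevich–Zagier 2001, §1.2, rule (3)] [folklore] (verbatim copy of
`Summit.KontsevichZagierPeriods.ArrangementNormalForm.JanusBands.IntegrateOut.newtonLeibniz_pack`) -/
private theorem newtonLeibniz_pack {N : ℕ} {τ : Set (Fin N → ℝ)} (hτ : IsSemialgebraic ℚ τ)
    {a b : (Fin N → ℝ) → ℝ} (ha : IsSemialgebraicFunOn ℚ τ a) (hb : IsSemialgebraicFunOn ℚ τ b)
    (hab : ∀ x ∈ τ, a x < b x) {f F : (Fin (N + 1) → ℝ) → ℝ}
    (hf : IsSemialgebraicFunOn ℚ (KZlog.band τ a b) f)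
    (hF : IsSemialgebraicFunOn ℚ (KZlog.band τ a b) F)
    (hcont : ∀ x ∈ τ, ContinuousOn (fun t => F (Fin.snoc x t)) (Icc (a x) (b x)))
    (hder : ∀ x ∈ τ, ∀ t ∈ Ioo (a x) (b x),
      HasDerivAt (fun s => F (Fin.snoc x s)) (f (Fin.snoc x t)) t)
    (r : KZ.IntegralRep (N + 1))
    (hrd : r.domain = {z | (Fin.init z : Fin N → ℝ) ∈ τ ∧ a (Fin.init z) < z (Fin.last N) ∧
      z (Fin.last N) < b (Fin.init z)})
    (hri : EqOn r.integrand f r.domain) :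
    ∃ r' : KZ.IntegralRep N, r'.domain = τ ∧
      (r'.integrand = fun x => F (Fin.snoc x (b x)) - F (Fin.snoc x (a x))) ∧
      KZ.of r - KZ.of r' ∈ KZ.relations := by
  have hτm : MeasurableSet τ := IsSemialgebraic.measurableSet_holds hτ
  have hBsa : IsSemialgebraic ℚ (KZlog.band τ a b) := KZlog.isSemialgebraic_band ha hb
  have hBm : MeasurableSet (KZlog.band τ a b) := IsSemialgebraic.measurableSet_holds hBsa
  have hsub : r.domain ⊆ KZlog.band τ a b := by
    rw [hrd]; exact fun z hz => ⟨hz.1, hz.2.1.le, hz.2.2.le⟩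
  have hdiff : KZlog.band τ a b \ r.domain ⊆
      {z | (Fin.init z : Fin N → ℝ) ∈ τ ∧ z (Fin.last N) = a (Fin.init z)} ∪
        {z | (Fin.init z : Fin N → ℝ) ∈ τ ∧ z (Fin.last N) = b (Fin.init z)} := by
    rw [hrd]
    rintro z ⟨⟨hzτ, h1, h2⟩, hz⟩
    simp only [mem_setOf_eq, not_and, not_lt] at hz
    rcases h1.lt_or_eq with h1 | h1
    · exact Or.inr ⟨hzτ, le_antisymm h2 (hz hzτ h1)⟩
    · exact Or.inl ⟨hzτ, h1.symm⟩
  have hnull : volume (KZlog.band τ a b \ r.domain) = 0 :=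
    measure_mono_null hdiff (measure_union_null (KZ.volume_graph_eq_zero ha)
      (KZ.volume_graph_eq_zero hb))
  have hfO : IntegrableOn f r.domain :=
    r.integrableOn.congr_fun hri (KZ.IntegralRep.measurableSet_domain_holds r)
  have hfB : IntegrableOn f (KZlog.band τ a b) := by
    rw [← Set.union_sdiff_cancel hsub]
    exact integrableOn_union.mpr ⟨hfO, IntegrableOn.of_measure_zero hnull⟩
  let r₂ : KZ.IntegralRep (N + 1) := ⟨KZlog.band τ a b, f, hBsa, hf, hfB⟩
  have h12 : KZ.of r - KZ.of r₂ ∈ KZ.relations := by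
    refine KZ.of_sub_of_mem_relations_of_null r r₂ ?_ hnull fun z hz => hri hz.1
    rw [Set.sdiff_eq_empty.mpr hsub, measure_empty]
  -- the base integrand and its semialgebraicity
  have hmap : ∀ {c : (Fin N → ℝ) → ℝ}, IsSemialgebraicFunOn ℚ τ c →
      (∀ x ∈ τ, c x ∈ Icc (a x) (b x)) →
      IsSemialgebraicFunOn ℚ τ (fun x => F (Fin.snoc x (c x))) := by
    intro c hc hcm
    have hφ : IsSemialgebraicMapOn ℚ τ (fun x => (Fin.snoc x (c x) : Fin (N + 1) → ℝ)) := by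
      refine IsSemialgebraicMapOn.of_forall hτ fun j => ?_
      refine Fin.lastCases ?_ (fun i => ?_) j
      · simpa using hc
      · simpa using isSemialgebraicFunOn_apply hτ i
    exact IsSemialgebraicFunOn.comp_isSemialgebraicMapOn_holds hF hφ
      fun x hx => KZlog.snoc_mem_band.mpr ⟨hx, hcm x hx⟩
  have hgsa : IsSemialgebraicFunOn ℚ τ (fun x => F (Fin.snoc x (b x)) - F (Fin.snoc x (a x))) :=
    IsSemialgebraicFunOn.sub_holds (hmap hb fun x hx => Set.right_mem_Icc.mpr (hab x hx).le)
      (hmap ha fun x hx => Set.left_mem_Icc.mpr (hab x hx).le)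
  -- integrability of the base integrand: Fubini and the fundamental theorem of calculus
  set G : (Fin (N + 1) → ℝ) → ℝ := (KZlog.band τ a b).indicator f with hG_def
  have hG : Integrable G := (integrable_indicator_iff hBm).mpr hfB
  obtain ⟨e, he, he_symm⟩ := exists_measurableEquiv_snoc N
  have hG2 : Integrable (fun q : (Fin N → ℝ) × ℝ => G (Fin.snoc q.1 q.2))
      ((volume : Measure (Fin N → ℝ)).prod (volume : Measure ℝ)) := by
    have h := ((he.symm e).integrable_comp_emb e.symm.measurableEmbedding (g := G)).mpr hG
    convert h using 1
    ext q
    simp [he_symm]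
  have hfib_in : ∀ x ∈ τ, (fun t => G (Fin.snoc x t)) =
      (Icc (a x) (b x)).indicator (fun t => f (Fin.snoc x t)) := by
    intro x hx
    ext t
    by_cases ht : t ∈ Icc (a x) (b x)
    · rw [indicator_of_mem ht, hG_def, indicator_of_mem (KZlog.snoc_mem_band.mpr ⟨hx, ht⟩)]
    · rw [indicator_of_notMem ht, hG_def,
        indicator_of_notMem (fun h => ht (KZlog.snoc_mem_band.mp h).2)]
  have hgx : ∀ x ∈ τ, Integrable (fun t => G (Fin.snoc x t)) →
      F (Fin.snoc x (b x)) - F (Fin.snoc x (a x)) = ∫ t, G (Fin.snoc x t) := by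
    intro x hx hxi
    rw [hfib_in x hx, integral_indicator measurableSet_Icc, integral_Icc_eq_integral_Ioc,
      ← intervalIntegral.integral_of_le (hab x hx).le]
    refine (intervalIntegral.integral_eq_sub_of_hasDerivAt_of_le (hab x hx).le (hcont x hx)
      (hder x hx) ?_).symm
    rw [intervalIntegrable_iff_integrableOn_Icc_of_le (hab x hx).le]
    have h' := hxi
    rw [hfib_in x hx] at h'
    exact (integrable_indicator_iff measurableSet_Icc).mp h'
  have hgi : IntegrableOn (fun x => F (Fin.snoc x (b x)) - F (Fin.snoc x (a x))) τ := by
    refine Integrable.mono' hG2.integral_norm_prod_left.integrableOn.integrable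
      (KZ.aestronglyMeasurable_of_isSemialgebraicFunOn hgsa hτm) ?_
    rw [ae_restrict_iff' hτm]
    filter_upwards [hG2.prod_right_ae] with x hx hxτ
    rw [hgx x hxτ hx]
    exact norm_integral_le_integral_norm _
  let r' : KZ.IntegralRep N :=
    ⟨τ, fun x => F (Fin.snoc x (b x)) - F (Fin.snoc x (a x)), hτ, hgsa, hgi⟩
  have h23 : KZ.of r₂ - KZ.of r' ∈ KZ.relations :=
    KZ.newtonLeibnizRel_subset_relations ⟨N, r₂, r', a, b, F, hF, ha, hb,
      fun x hx => (hab x hx).le, rfl, hcont, hder, fun x _ => rfl, rfl⟩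
  refine ⟨r', rfl, rfl, ?_⟩
  have : KZ.of r - KZ.of r' = (KZ.of r - KZ.of r₂) + (KZ.of r₂ - KZ.of r') := by abel
  rw [this]
  exact KZ.relations.add_mem h12 h23

open Literature.ModelTheory.ExponentialFields (IsSemialgebraic)

open Literature.ModelTheory.ExponentialFields (IsSemialgebraic)

open Literature.ModelTheory.ExponentialFields (IsSemialgebraic)

/-- **(E1₃) Newton–Leibniz on `Δ₃` in the last coordinate** (rule 3, via a verbatim private copy of `JanusBands.IntegrateOut.newtonLeibniz_pack`): every
representation of `f = ∂₂F` on `Δ₃` is congruent to `[Δ₂, F(t₀,t₁,t₁) - F(t₀,t₁,0)]`. [Kontsevich–Zagier 2001 §1.2 rule (3)] -/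
theorem nlB3 {f F : (Fin 3 → ℝ) → ℝ} (hf : IsSemialgebraicFunOn ℚ bandB3 f) (hF : IsSemialgebraicFunOn ℚ bandB3 F)
    (hcont : ∀ y ∈ KZ.openOrderedSimplex 2, ContinuousOn (fun t => F (Fin.snoc y t)) (Icc 0 (y (Fin.last 1))))
    (hder : ∀ y ∈ KZ.openOrderedSimplex 2, ∀ t ∈ Ioo 0 (y (Fin.last 1)),
      HasDerivAt (fun s => F (Fin.snoc y s)) (f (Fin.snoc y t)) t)
    (r : KZ.IntegralRep 3) (hd : r.domain = KZ.openOrderedSimplex 3) (hi : EqOn r.integrand f r.domain) :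
    ∃ r' : KZ.IntegralRep 2, r'.domain = KZ.openOrderedSimplex 2 ∧
      (r'.integrand = fun y => F (Fin.snoc y (y (Fin.last 1))) - F (Fin.snoc y 0)) ∧
      KZ.of r - KZ.of r' ∈ KZ.relations := by
  have hτ := KZ.isSemialgebraic_openOrderedSimplex 2
  have ha : IsSemialgebraicFunOn ℚ (KZ.openOrderedSimplex 2) (fun _ : Fin 2 → ℝ => (0 : ℝ)) :=
    (isSemialgebraicFunOn_aeval hτ (0 : MvPolynomial (Fin 2) ℚ)).congr fun y _ => by simp
  have hb : IsSemialgebraicFunOn ℚ (KZ.openOrderedSimplex 2) (fun y : Fin 2 → ℝ => y (Fin.last 1)) :=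
    (isSemialgebraicFunOn_aeval hτ (MvPolynomial.X (Fin.last 1))).congr fun y _ => by simp
  have hab : ∀ y ∈ KZ.openOrderedSimplex 2, (fun _ : Fin 2 → ℝ => (0 : ℝ)) y < (fun y : Fin 2 → ℝ => y (Fin.last 1)) y :=
    fun y hy => ((mem_simplex_two_iff y).1 hy).1
  exact newtonLeibniz_pack hτ ha hb hab hf hF hcont hder r (by rw [hd]; exact simplex3_eq_openBand) hi

/-- Auxiliary step `snocB3_zero`. [bookkeeping] -/
private theorem snocB3_zero (x : Fin 2 → ℝ) (t : ℝ) : (Fin.snoc x t : Fin 3 → ℝ) 0 = x 0 := rfl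
/-- Auxiliary step `snocB3_one`. [bookkeeping] -/
private theorem snocB3_one (x : Fin 2 → ℝ) (t : ℝ) : (Fin.snoc x t : Fin 3 → ℝ) 1 = x 1 := rfl
/-- Auxiliary step `snocB3_two`. [bookkeeping] -/
private theorem snocB3_two (x : Fin 2 → ℝ) (t : ℝ) : (Fin.snoc x t : Fin 3 → ℝ) 2 = t := rfl

/-- Family A: `q·(1-t₀)^κ₀ (t₀-t₁)^κ₁ t₂^n / (t₀^β₀ t₁^β₁ (1-t₁)^γ₁)` -/
def famA (q : ℚ) (κ0 κ1 n β₀ β₁ γ₁ : ℕ) (t : Fin 3 → ℝ) : ℝ :=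
  (q : ℝ) * ((1 - t 0) ^ κ0 * (t 0 - t 1) ^ κ1 * t 2 ^ n) / (t 0 ^ β₀ * t 1 ^ β₁ * (1 - t 1) ^ γ₁)

/-- its primitive in `t₂` vanishing at `t₂ = 0` -/
def FamA (q : ℚ) (κ0 κ1 n β₀ β₁ γ₁ : ℕ) (t : Fin 3 → ℝ) : ℝ :=
  (q : ℝ) * ((1 - t 0) ^ κ0 * (t 0 - t 1) ^ κ1 * t 2 ^ (n + 1)) / (((n : ℝ) + 1) * (t 0 ^ β₀ * t 1 ^ β₁ * (1 - t 1) ^ γ₁))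

/-- Auxiliary step `gapF_famA`. [bookkeeping] -/
theorem gapF_famA (q : ℚ) (κ0 κ1 n β₀ β₁ γ₁ : ℕ) (t : Fin 3 → ℝ) :
    (q : ℝ) * gapF ![κ0, κ1, 0, n] β₀ β₁ γ₁ 0 0 t = famA q κ0 κ1 n β₀ β₁ γ₁ t := by
  simp [gapF, famA]
  ring

/-- Auxiliary step `famA_sa`. [bookkeeping] -/
theorem famA_sa (q : ℚ) (κ0 κ1 n β₀ β₁ γ₁ : ℕ) : IsSemialgebraicFunOn ℚ bandB3 (famA q κ0 κ1 n β₀ β₁ γ₁) := by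
  refine (isSemialgebraicFunOn_aeval_div_aeval isSemialgebraic_bandB3
    (MvPolynomial.C q * ((MvPolynomial.C 1 - MvPolynomial.X 0) ^ κ0 * (MvPolynomial.X 0 - MvPolynomial.X 1) ^ κ1 * MvPolynomial.X 2 ^ n))
    (MvPolynomial.X 0 ^ β₀ * MvPolynomial.X 1 ^ β₁ * (MvPolynomial.C 1 - MvPolynomial.X 1) ^ γ₁) fun z hz => ?_).congr fun z hz => ?_
  · obtain ⟨h0, h1, h1', -, -⟩ := bandB3_facts hz
    simp only [map_mul, map_pow, map_sub, MvPolynomial.aeval_X, map_one]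
    exact mul_ne_zero (mul_ne_zero (pow_ne_zero _ h0) (pow_ne_zero _ h1)) (pow_ne_zero _ h1')
  · simp only [map_mul, map_pow, map_sub, MvPolynomial.aeval_X, MvPolynomial.aeval_C, map_one, famA, eq_ratCast]

/-- Auxiliary step `FamA_sa`. [bookkeeping] -/
theorem FamA_sa (q : ℚ) (κ0 κ1 n β₀ β₁ γ₁ : ℕ) : IsSemialgebraicFunOn ℚ bandB3 (FamA q κ0 κ1 n β₀ β₁ γ₁) := by
  refine (isSemialgebraicFunOn_aeval_div_aeval isSemialgebraic_bandB3
    (MvPolynomial.C q * ((MvPolynomial.C 1 - MvPolynomial.X 0) ^ κ0 * (MvPolynomial.X 0 - MvPolynomial.X 1) ^ κ1 *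
      MvPolynomial.X 2 ^ (n + 1)))
    (MvPolynomial.C ((n : ℚ) + 1) * (MvPolynomial.X 0 ^ β₀ * MvPolynomial.X 1 ^ β₁ * (MvPolynomial.C 1 - MvPolynomial.X 1) ^ γ₁))
    fun z hz => ?_).congr fun z hz => ?_
  · obtain ⟨h0, h1, h1', -, -⟩ := bandB3_facts hz
    simp only [map_mul, map_pow, map_sub, map_add, map_natCast, MvPolynomial.aeval_X, map_one]
    have hn : ((n : ℝ) + 1) ≠ 0 := by positivity
    exact mul_ne_zero (by simpa using hn) (mul_ne_zero (mul_ne_zero (pow_ne_zero _ h0) (pow_ne_zero _ h1)) (pow_ne_zero _ h1'))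
  · simp only [map_mul, map_pow, map_sub, map_add, map_natCast, MvPolynomial.aeval_X, MvPolynomial.aeval_C, map_one, FamA,
      eq_ratCast]

/-- Auxiliary step `FamA_cont`. [bookkeeping] -/
theorem FamA_cont (q : ℚ) (κ0 κ1 n β₀ β₁ γ₁ : ℕ) : ∀ y ∈ KZ.openOrderedSimplex 2,
    ContinuousOn (fun t => FamA q κ0 κ1 n β₀ β₁ γ₁ (Fin.snoc y t)) (Icc 0 (y (Fin.last 1))) := by
  intro y hy
  show ContinuousOn (fun s : ℝ => (q : ℝ) * ((1 - y 0) ^ κ0 * (y 0 - y 1) ^ κ1 * s ^ (n + 1)) /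
    (((n : ℝ) + 1) * (y 0 ^ β₀ * y 1 ^ β₁ * (1 - y 1) ^ γ₁))) (Icc 0 (y 1))
  exact Continuous.continuousOn (by fun_prop)

/-- Auxiliary step `FamA_der`. [bookkeeping] -/
theorem FamA_der (q : ℚ) (κ0 κ1 n β₀ β₁ γ₁ : ℕ) : ∀ y ∈ KZ.openOrderedSimplex 2, ∀ t ∈ Ioo 0 (y (Fin.last 1)),
    HasDerivAt (fun s => FamA q κ0 κ1 n β₀ β₁ γ₁ (Fin.snoc y s)) (famA q κ0 κ1 n β₀ β₁ γ₁ (Fin.snoc y t)) t := by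
  intro y hy t ht
  obtain ⟨h1, h10, h0⟩ := (mem_simplex_two_iff y).1 hy
  show HasDerivAt (fun s : ℝ => (q : ℝ) * ((1 - y 0) ^ κ0 * (y 0 - y 1) ^ κ1 * s ^ (n + 1)) /
      (((n : ℝ) + 1) * (y 0 ^ β₀ * y 1 ^ β₁ * (1 - y 1) ^ γ₁)))
    ((q : ℝ) * ((1 - y 0) ^ κ0 * (y 0 - y 1) ^ κ1 * t ^ n) / (y 0 ^ β₀ * y 1 ^ β₁ * (1 - y 1) ^ γ₁)) t
  have hD : y 0 ^ β₀ * y 1 ^ β₁ * (1 - y 1) ^ γ₁ ≠ 0 :=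
    mul_ne_zero (mul_ne_zero (pow_ne_zero _ (by linarith)) (pow_ne_zero _ (by linarith))) (pow_ne_zero _ (by linarith))
  have hn : ((n : ℝ) + 1) ≠ 0 := by positivity
  have h := (((hasDerivAt_pow (n + 1) t).const_mul ((1 - y 0) ^ κ0 * (y 0 - y 1) ^ κ1)).const_mul (q : ℝ)).div_const
    (((n : ℝ) + 1) * (y 0 ^ β₀ * y 1 ^ β₁ * (1 - y 1) ^ γ₁))
  refine h.congr_deriv ?_
  push_cast
  field_simp

/-- **Family A lowered**: one NL move takes `[Δ₃, famA]` to a genus-zero datum of dimension 2 (`β₁ ≤ n + 1`). -/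
theorem famA_lower (q : ℚ) (κ0 κ1 n β₀ β₁ γ₁ : ℕ) (hE1 : β₁ ≤ n + 1) (r : KZ.IntegralRep 3) (hd : r.domain = KZ.openOrderedSimplex 3)
    (hi : EqOn r.integrand (famA q κ0 κ1 n β₀ β₁ γ₁) r.domain) :
    ∃ r' : KZ.IntegralRep 2, r'.domain = KZ.openOrderedSimplex 2 ∧
      EqOn r'.integrand (fun y => MvPolynomial.aeval y (MvPolynomial.C (q / ((n : ℚ) + 1)) *
        ((MvPolynomial.C 1 - MvPolynomial.X 0) ^ κ0 * (MvPolynomial.X 0 - MvPolynomial.X 1) ^ κ1 * MvPolynomial.X 1 ^ (n + 1 - β₁))) /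
        (y 0 ^ β₀ * (1 - y 1) ^ γ₁)) r'.domain ∧
      KZ.of r - KZ.of r' ∈ KZ.relations := by
  obtain ⟨r', hd', hi', hrel⟩ := nlB3 (famA_sa q κ0 κ1 n β₀ β₁ γ₁) (FamA_sa q κ0 κ1 n β₀ β₁ γ₁) (FamA_cont q κ0 κ1 n β₀ β₁ γ₁)
    (FamA_der q κ0 κ1 n β₀ β₁ γ₁) r hd hi
  refine ⟨r', hd', fun y hy => ?_, hrel⟩
  rw [hd'] at hy
  obtain ⟨h1, h10, h0⟩ := (mem_simplex_two_iff y).1 hy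
  rw [hi']
  show FamA q κ0 κ1 n β₀ β₁ γ₁ (Fin.snoc y (y (Fin.last 1))) - FamA q κ0 κ1 n β₀ β₁ γ₁ (Fin.snoc y 0) = _
  simp only [FamA, snocB3_zero, snocB3_one, snocB3_two, show y (Fin.last 1) = y 1 from rfl, zero_pow (Nat.succ_ne_zero n), mul_zero,
    zero_div, sub_zero, map_mul, map_pow, map_sub, MvPolynomial.aeval_X, MvPolynomial.aeval_C, map_one, eq_ratCast]
  obtain ⟨m, hm⟩ : ∃ m, n + 1 = m + β₁ := ⟨n + 1 - β₁, by omega⟩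
  rw [show n + 1 - β₁ = m by omega, hm, pow_add]
  have hy0 : y 0 ≠ 0 := by linarith
  have hy1 : y 1 ≠ 0 := by linarith
  have hy1' : (1 : ℝ) - y 1 ≠ 0 := by linarith
  have hn : ((n : ℝ) + 1) ≠ 0 := by positivity
  push_cast
  field_simp

end GapNL

end Summit.KontsevichZagierPeriods.RootDecompZetaThreeFrontier.WordLayer

namespace Summit.KontsevichZagierPeriods.KontsevichZagierPeriods.Cruxes.GZNormalFormWThree.GZLadder

open Set MeasureTheory Literature.NumberTheory.Transcendental
open Summit.KontsevichZagierPeriods.RootDecompZetaThreeFrontier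

/-- **`GapClassMatch`, FAMILY A, PROVED** (first non-layer family: `κ₂ = 0`, `γ₂ = α = 0`, `β₁ ≤ n+1` unrestricted by the layer bound):
the class is congruent to a genus-zero datum of dimension `2`, hence into `gzLETwo`. -/
theorem gapClassMatch_famA (q : ℚ) (κ0 κ1 n β₀ β₁ γ₁ : ℕ) (hE1 : β₁ ≤ n + 1) (r : KZ.IntegralRep 3) (hd : r.domain = simplex 3)
    (hi : EqOn r.integrand (fun t => (q : ℝ) * WordLayer.gapF ![κ0, κ1, 0, n] β₀ β₁ γ₁ 0 0 t) r.domain) :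
    CongInto (layerThree ∪ gzLETwo) (KZ.of r) := by
  have hi' : EqOn r.integrand (WordLayer.famA q κ0 κ1 n β₀ β₁ γ₁) r.domain := fun t ht => by
    rw [hi ht]; exact WordLayer.gapF_famA q κ0 κ1 n β₀ β₁ γ₁ t
  obtain ⟨r', hd', hi'', hrel⟩ := WordLayer.famA_lower q κ0 κ1 n β₀ β₁ γ₁ hE1 r hd hi'
  refine ⟨KZ.of r', AddSubgroup.subset_closure (Or.inr ⟨2, r', le_rfl, ⟨hd',
    MvPolynomial.C (q / ((n : ℚ) + 1)) * ((MvPolynomial.C 1 - MvPolynomial.X 0) ^ κ0 * (MvPolynomial.X 0 - MvPolynomial.X 1) ^ κ1 *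
      MvPolynomial.X 1 ^ (n + 1 - β₁)), fun _ _ => 0, ![β₀, 0], ![0, γ₁], fun y hy => ?_⟩, rfl⟩), hrel⟩
  rw [hi'' hy]
  simp [Fin.prod_univ_two]

end Summit.KontsevichZagierPeriods.KontsevichZagierPeriods.Cruxes.GZNormalFormWThree.GZLadder

/-! # §30  THE GENERIC t₂-INTEGRATION-BY-PARTS ENGINE (decomp-kz lens-1 gen 11): for EVERY polynomial `P ∈ ℚ[t₀,t₁,t₂]` and exponents,
`[Δ₃, ibpQ(P)/(t₀^β₀ t₁^β₁ (1-t₁)^γ₁ (1-t₂)^{γ₂+1} (t₀-t₂)^{α+1})] ≡ [Δ₂, genus-zero datum]`, where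
`ibpQ(P) = ∂₂P·(1-t₂)(t₀-t₂) + P·(γ₂ (t₀-t₂) + α (1-t₂))` is `∂₂` of `P/(… (1-t₂)^{γ₂} (t₀-t₂)^{α})` cleared of denominators, and the
boundary terms `F(t₀,t₁,t₁) - F(t₀,t₁,0)` combine over the common denominator `y₀^{β₀+α} y₁^{β₁} (1-y₁)^{γ₁+γ₂} (y₀-y₁)^{α}` into ONE
genus-zero datum of dimension 2.  Hence every such class is `CongInto (layerThree ∪ gzLETwo)`; what remains of `GapClassMatch` in the
t₂-direction is the algebraic INTEGRATION problem `q·g^κ·(extra factors) = ibpQ(P) + (layer numerators)`. -/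

namespace Summit.KontsevichZagierPeriods.RootDecompZetaThreeFrontier.WordLayer

open Set MeasureTheory Literature.NumberTheory.Transcendental
open Literature.ModelTheory.ExponentialFields (IsSemialgebraic)
open Summit.KontsevichZagierPeriods.KontsevichZagierPeriods.Theorems.RootDecompZetaThreeFrontierWordMoves (mem_simplex_two_iff mem_simplex_three_iff)

section IBPT2

end IBPT2
end Summit.KontsevichZagierPeriods.RootDecompZetaThreeFrontier.WordLayer
end
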